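import Mathlib
import HarnessLib

/-!
# Stub `stub_transformFinite` of line `Sketch` (crux `EntropyRung.ConicalGap`, stmt-SmoothPoincare4-16589)

Wang–Wang 2023 (arXiv:2308.06560, proof of Prop. 2.6, (2.7)–(2.10)), the finite-`T` density
transform, stated and proved as PURE MEASURE THEORY. Let `μ` be a σ-finite measure on a measurable
space `X`, `f, R : X → ℝ` measurable with `f, R ≥ 0`, and suppose that for every `τ > 0` the three
weights `e^{-f/τ}`, `f e^{-f/τ}`, `R e^{-f/τ}` are `μ`-integrable and the weighted identity
`∫ (f − 2τ) e^{-f/τ} dμ = (1 − τ) ∫ R e^{-f/τ} dμ` holds. Then for every `T ≥ 1`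

  `∫ e^{-f} dμ = T⁻² ∫ e^{-f/T} dμ + ∫ R(x) k_T(f(x)) dμ(x)`,
  `k_T(t) = ∫₁^T (τ − 1) τ⁻⁴ e^{-t/τ} dτ`,

and `x ↦ R(x) k_T(f(x))` is `μ`-integrable.

Proof: the pointwise primitive `∂_τ (τ⁻² e^{-t/τ}) = τ⁻⁴ (t − 2τ) e^{-t/τ}`
(`transformFinite_hasDerivAt`, FTC `transformFinite_ftc`) gives
`T⁻² e^{-f/T} − e^{-f} = ∫₁^T τ⁻⁴ (f − 2τ) e^{-f/τ} dτ`; integrate over `X`, swap the integrals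
(Fubini on `X × (1, T]`, `transformFinite_swapF`, domination by `(f + 2T) e^{-f/T}`), apply the
weighted identity slice-wise, and swap back (`transformFinite_swapG`, domination by `T R e^{-f/T}`).

Everything here is proved from Mathlib; no definition and no named fact is introduced.

## References

* Y. Wang, G. Wang (Wang–Wang 2023), arXiv:2308.06560, Prop. 2.6, (2.7)–(2.10).
-/

noncomputable section

-- `Summit.SmoothPoincare4.SmoothPoincare4.…` (summit = problem) trips `dupNamespace` on every decl.
set_option linter.dupNamespace false

open MeasureTheory Set Filter

namespace Summit.SmoothPoincare4.SmoothPoincare4.Theorems.ConicalGapSketch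

/-! ## The primitive `τ ↦ τ⁻² e^{-t/τ}` -/

/-- `∂_τ (τ⁻² e^{-t/τ}) = τ⁻⁴ (t − 2τ) e^{-t/τ}` for `τ ≠ 0`. -/
theorem transformFinite_hasDerivAt (t : ℝ) {τ : ℝ} (hτ : τ ≠ 0) :
    HasDerivAt (fun s : ℝ ↦ (s ^ 2)⁻¹ * Real.exp (-t / s))
      ((τ ^ 4)⁻¹ * ((t - 2 * τ) * Real.exp (-t / τ))) τ := by
  have h1 := (hasDerivAt_pow 2 τ).fun_inv (pow_ne_zero 2 hτ)
  have h2 := ((hasDerivAt_const τ (-t)).fun_div (hasDerivAt_id' (x := τ)) hτ).exp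
  refine (h1.fun_mul h2).congr_deriv ?_
  have h3 : ((2 : ℕ) : ℝ) * τ ^ (2 - 1) = 2 * τ := by norm_num
  rw [h3]
  field_simp
  ring

/-- FTC for the primitive: `∫₁^T τ⁻⁴ (t − 2τ) e^{-t/τ} dτ = T⁻² e^{-t/T} − e^{-t}` (`T ≥ 1`). -/
theorem transformFinite_ftc (t : ℝ) {T : ℝ} (hT : 1 ≤ T) :
    ∫ τ in (1 : ℝ)..T, (τ ^ 4)⁻¹ * ((t - 2 * τ) * Real.exp (-t / τ)) =
      (T ^ 2)⁻¹ * Real.exp (-t / T) - Real.exp (-t) := by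
  have hcont : ContinuousOn (fun τ : ℝ ↦ (τ ^ 4)⁻¹ * ((t - 2 * τ) * Real.exp (-t / τ)))
      (uIcc 1 T) := by
    rw [uIcc_of_le hT]
    refine continuousOn_of_forall_continuousAt fun τ hτ ↦ ?_
    have hτ0 : 0 < τ := one_pos.trans_le hτ.1
    fun_prop (disch := positivity)
  have hderiv : ∀ τ ∈ uIcc (1 : ℝ) T, HasDerivAt (fun s : ℝ ↦ (s ^ 2)⁻¹ * Real.exp (-t / s))
      ((τ ^ 4)⁻¹ * ((t - 2 * τ) * Real.exp (-t / τ))) τ := fun τ hτ ↦ by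
    rw [uIcc_of_le hT] at hτ
    exact transformFinite_hasDerivAt t (one_pos.trans_le hτ.1).ne'
  rw [intervalIntegral.integral_eq_sub_of_hasDerivAt hderiv hcont.intervalIntegrable]
  simp only [one_pow, inv_one, one_mul, div_one]

/-! ## Elementary bounds on `(1, T]` -/

/-- For `t ≥ 0` and `1 < τ ≤ T`: `e^{-t/τ} ≤ e^{-t/T}`. -/
theorem transformFinite_exp_le {t τ T : ℝ} (ht : 0 ≤ t) (hτ : τ ∈ Ioc 1 T) :
    Real.exp (-t / τ) ≤ Real.exp (-t / T) := by
  have hτ0 : 0 < τ := one_pos.trans hτ.1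
  rw [Real.exp_le_exp, neg_div, neg_div, neg_le_neg_iff]
  exact div_le_div_of_nonneg_left ht hτ0 hτ.2

/-- For `1 < τ ≤ T`: `τ⁻⁴ ≤ 1`. -/
theorem transformFinite_inv_pow_le {τ T : ℝ} (hτ : τ ∈ Ioc 1 T) : (τ ^ 4)⁻¹ ≤ 1 :=
  inv_le_one_of_one_le₀ (one_le_pow₀ hτ.1.le)

/-! ## Fubini on `X × (1, T]` -/

/-- Fubini–Tonelli on `X × (1, T]` under a domination `‖F x τ‖ ≤ b x` by an integrable `b`:
the jointly measurable `F` is integrable for `μ ⊗ vol|_{(1,T]}` and the two iterated integrals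
agree. -/
theorem transformFinite_swap {X : Type*} [MeasurableSpace X] (μ : Measure X) [SigmaFinite μ]
    (T : ℝ) (F : X → ℝ → ℝ) (b : X → ℝ) (hF : Measurable fun p : X × ℝ ↦ F p.1 p.2)
    (hb : Integrable b μ) (hdom : ∀ x, ∀ τ ∈ Ioc 1 T, ‖F x τ‖ ≤ b x) :
    Integrable (fun p : X × ℝ ↦ F p.1 p.2) (μ.prod (volume.restrict (Ioc 1 T))) ∧
      ∫ x, (∫ τ in Ioc 1 T, F x τ) ∂μ = ∫ τ in Ioc 1 T, ∫ x, F x τ ∂μ := by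
  have hμ : μ.prod (volume.restrict (Ioc 1 T)) =
      (μ.prod volume).restrict (univ ×ˢ Ioc 1 T) := by
    rw [← Measure.prod_restrict, Measure.restrict_univ]
  have hint : Integrable (fun p : X × ℝ ↦ F p.1 p.2) (μ.prod (volume.restrict (Ioc 1 T))) := by
    refine (hb.comp_fst (volume.restrict (Ioc 1 T))).mono' hF.aestronglyMeasurable ?_
    rw [hμ]
    filter_upwards [ae_restrict_mem (MeasurableSet.univ.prod measurableSet_Ioc)] with p hp
    exact hdom p.1 p.2 hp.2
  exact ⟨hint, integral_integral_swap hint⟩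

/-- Fubini for the first integrand `τ⁻⁴ (f − 2τ) e^{-f/τ}` on `X × (1, T]`, dominated by
`(f + 2T) e^{-f/T}`. -/
theorem transformFinite_swapF {X : Type*} [MeasurableSpace X] (μ : Measure X) [SigmaFinite μ]
    {f : X → ℝ} (hfm : Measurable f) (hf0 : ∀ x, 0 ≤ f x) {T : ℝ}
    (hA : Integrable (fun x ↦ Real.exp (-f x / T)) μ)
    (hB : Integrable (fun x ↦ f x * Real.exp (-f x / T)) μ) :
    Integrable (fun p : X × ℝ ↦ (p.2 ^ 4)⁻¹ * ((f p.1 - 2 * p.2) * Real.exp (-f p.1 / p.2)))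
        (μ.prod (volume.restrict (Ioc 1 T))) ∧
      ∫ x, (∫ τ in Ioc 1 T, (τ ^ 4)⁻¹ * ((f x - 2 * τ) * Real.exp (-f x / τ))) ∂μ =
        ∫ τ in Ioc 1 T, ∫ x, (τ ^ 4)⁻¹ * ((f x - 2 * τ) * Real.exp (-f x / τ)) ∂μ := by
  have hmeas : Measurable fun p : X × ℝ ↦
      (p.2 ^ 4)⁻¹ * ((f p.1 - 2 * p.2) * Real.exp (-f p.1 / p.2)) := by
    fun_prop
  have hb : Integrable (fun x ↦ (f x + 2 * T) * Real.exp (-f x / T)) μ :=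
    (hB.add (hA.const_mul (2 * T))).congr (Eventually.of_forall fun x ↦ by
      simp only [Pi.add_apply]; ring)
  refine transformFinite_swap μ T (fun x τ ↦ (τ ^ 4)⁻¹ * ((f x - 2 * τ) * Real.exp (-f x / τ)))
    (fun x ↦ (f x + 2 * T) * Real.exp (-f x / T)) hmeas hb fun x τ hτ ↦ ?_
  have hτ0 : 0 < τ := one_pos.trans hτ.1
  have h1 := transformFinite_inv_pow_le hτ
  have h2 : |f x - 2 * τ| ≤ f x + 2 * T :=
    abs_le.2 ⟨by linarith [hf0 x, hτ.1, hτ.2], by linarith [hf0 x, hτ.1, hτ.2]⟩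
  have h3 := transformFinite_exp_le (hf0 x) hτ
  have h4 : 0 ≤ f x + 2 * T := by linarith [hf0 x, hτ.1, hτ.2]
  rw [Real.norm_eq_abs, abs_mul, abs_mul, abs_inv, abs_of_pos (pow_pos hτ0 4), Real.abs_exp]
  calc (τ ^ 4)⁻¹ * (|f x - 2 * τ| * Real.exp (-f x / τ))
      ≤ 1 * ((f x + 2 * T) * Real.exp (-f x / T)) :=
        mul_le_mul h1 (mul_le_mul h2 h3 (Real.exp_pos _).le h4) (by positivity) zero_le_one
    _ = (f x + 2 * T) * Real.exp (-f x / T) := one_mul _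

/-- Fubini for the second integrand `τ⁻⁴ (1 − τ) R e^{-f/τ}` on `X × (1, T]`, dominated by
`T R e^{-f/T}`. -/
theorem transformFinite_swapG {X : Type*} [MeasurableSpace X] (μ : Measure X) [SigmaFinite μ]
    {f R : X → ℝ} (hfm : Measurable f) (hRm : Measurable R) (hf0 : ∀ x, 0 ≤ f x)
    (hR0 : ∀ x, 0 ≤ R x) {T : ℝ} (hC : Integrable (fun x ↦ R x * Real.exp (-f x / T)) μ) :
    Integrable (fun p : X × ℝ ↦ (p.2 ^ 4)⁻¹ * ((1 - p.2) * (R p.1 * Real.exp (-f p.1 / p.2))))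
        (μ.prod (volume.restrict (Ioc 1 T))) ∧
      ∫ x, (∫ τ in Ioc 1 T, (τ ^ 4)⁻¹ * ((1 - τ) * (R x * Real.exp (-f x / τ)))) ∂μ =
        ∫ τ in Ioc 1 T, ∫ x, (τ ^ 4)⁻¹ * ((1 - τ) * (R x * Real.exp (-f x / τ))) ∂μ := by
  have hmeas : Measurable fun p : X × ℝ ↦
      (p.2 ^ 4)⁻¹ * ((1 - p.2) * (R p.1 * Real.exp (-f p.1 / p.2))) := by
    fun_prop
  refine transformFinite_swap μ T
    (fun x τ ↦ (τ ^ 4)⁻¹ * ((1 - τ) * (R x * Real.exp (-f x / τ))))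
    (fun x ↦ T * (R x * Real.exp (-f x / T))) hmeas (hC.const_mul T) fun x τ hτ ↦ ?_
  have hτ0 : 0 < τ := one_pos.trans hτ.1
  have hT0 : 0 ≤ T := by linarith [hτ.1, hτ.2]
  have h1 := transformFinite_inv_pow_le hτ
  have h2 : |1 - τ| ≤ T := by
    rw [abs_sub_comm, abs_of_nonneg (by linarith [hτ.1])]
    linarith [hτ.2]
  have h3 := transformFinite_exp_le (hf0 x) hτ
  rw [Real.norm_eq_abs, abs_mul, abs_mul, abs_mul, abs_inv, abs_of_pos (pow_pos hτ0 4),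
    Real.abs_exp, abs_of_nonneg (hR0 x)]
  calc (τ ^ 4)⁻¹ * (|1 - τ| * (R x * Real.exp (-f x / τ)))
      ≤ 1 * (T * (R x * Real.exp (-f x / T))) :=
        mul_le_mul h1 (mul_le_mul h2 (mul_le_mul_of_nonneg_left h3 (hR0 x))
          (mul_nonneg (hR0 x) (Real.exp_pos _).le) hT0)
          (mul_nonneg (abs_nonneg _) (mul_nonneg (hR0 x) (Real.exp_pos _).le)) zero_le_one
    _ = T * (R x * Real.exp (-f x / T)) := one_mul _

/-! ## The registered stub -/

/-- **Stub `stub_transformFinite` of line `Sketch`** (Wang–Wang 2023, arXiv:2308.06560,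
(2.7)–(2.10), finite `T`): for a σ-finite Borel measure `μ`, continuous `f, R ≥ 0` whose three
weights `e^{-f/τ}, f e^{-f/τ}, R e^{-f/τ}` are integrable for every `τ > 0` and which satisfy the
weighted identity `∫ (f − 2τ) e^{-f/τ} dμ = (1 − τ) ∫ R e^{-f/τ} dμ` for every `τ > 0`, one has for
every `T ≥ 1` that `x ↦ R(x) ∫₁^T (τ − 1) τ⁻⁴ e^{-f(x)/τ} dτ` is integrable and
`∫ e^{-f} dμ = T⁻² ∫ e^{-f/T} dμ + ∫ R(x) (∫₁^T (τ − 1) τ⁻⁴ e^{-f(x)/τ} dτ) dμ`. -/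
theorem stub_transformFinite : ∀ (X : Type) [TopologicalSpace X] [SecondCountableTopology X] [MeasurableSpace X] [BorelSpace X] (μ : MeasureTheory.Measure X) [MeasureTheory.SigmaFinite μ] (f R : X → ℝ), Continuous f → Continuous R → (∀ x, 0 ≤ f x) → (∀ x, 0 ≤ R x) → (∀ τ : ℝ, 0 < τ → MeasureTheory.Integrable (fun x ↦ Real.exp (-f x / τ)) μ ∧ MeasureTheory.Integrable (fun x ↦ f x * Real.exp (-f x / τ)) μ ∧ MeasureTheory.Integrable (fun x ↦ R x * Real.exp (-f x / τ)) μ) → (∀ τ : ℝ, 0 < τ → ∫ x, (f x - 2 * τ) * Real.exp (-f x / τ) ∂μ = (1 - τ) * ∫ x, R x * Real.exp (-f x / τ) ∂μ) → ∀ T : ℝ, 1 ≤ T → MeasureTheory.Integrable (fun x ↦ R x * ∫ τ in (1 : ℝ)..T, (τ - 1) / τ ^ 4 * Real.exp (-f x / τ)) μ ∧ ∫ x, Real.exp (-f x) ∂μ = (T ^ 2)⁻¹ * (∫ x, Real.exp (-f x / T) ∂μ) + ∫ x, R x * (∫ τ in (1 : ℝ)..T, (τ - 1) / τ ^ 4 *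 Real.exp (-f x / τ)) ∂μ := by
  intro X _ _ _ _ μ _ f R hf hR hf0 hR0 hint hid T hT
  have hT0 : 0 < T := one_pos.trans_le hT
  obtain ⟨hA1, -, -⟩ := hint 1 one_pos
  obtain ⟨hAT, hBT, hCT⟩ := hint T hT0
  simp only [div_one] at hA1
  have hfm : Measurable f := hf.measurable
  have hRm : Measurable R := hR.measurable
  -- Fubini, twice
  obtain ⟨-, hFswap⟩ := transformFinite_swapF μ hfm hf0 hAT hBT
  obtain ⟨hGint, hGswap⟩ := transformFinite_swapG μ hfm hRm hf0 hR0 hCT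
  -- the weighted identity on each slice `τ ∈ (1, T]`
  have hinner : EqOn (fun τ : ℝ ↦ ∫ x, (τ ^ 4)⁻¹ * ((f x - 2 * τ) * Real.exp (-f x / τ)) ∂μ)
      (fun τ : ℝ ↦ ∫ x, (τ ^ 4)⁻¹ * ((1 - τ) * (R x * Real.exp (-f x / τ))) ∂μ) (Ioc 1 T) := by
    intro τ hτ
    have hτ0 : 0 < τ := one_pos.trans hτ.1
    beta_reduce
    rw [integral_const_mul, integral_const_mul, integral_const_mul, hid τ hτ0]
  -- the pointwise FTC at `t = f x`
  have hftc : ∀ x, ∫ τ in Ioc 1 T, (τ ^ 4)⁻¹ * ((f x - 2 * τ) * Real.exp (-f x / τ)) =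
      (T ^ 2)⁻¹ * Real.exp (-f x / T) - Real.exp (-f x) := fun x ↦ by
    rw [← intervalIntegral.integral_of_le hT]
    exact transformFinite_ftc (f x) hT
  -- the pointwise kernel `k_T(f x)`
  have hGk : ∀ x, ∫ τ in Ioc 1 T, (τ ^ 4)⁻¹ * ((1 - τ) * (R x * Real.exp (-f x / τ))) =
      -(R x * ∫ τ in (1 : ℝ)..T, (τ - 1) / τ ^ 4 * Real.exp (-f x / τ)) := fun x ↦ by
    rw [intervalIntegral.integral_of_le hT, ← integral_const_mul, ← integral_neg]
    refine integral_congr_ae (Eventually.of_forall fun τ ↦ ?_)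
    beta_reduce
    ring
  -- (i) integrability of `R k_T(f)`
  have hi : Integrable (fun x ↦ R x * ∫ τ in (1 : ℝ)..T, (τ - 1) / τ ^ 4 * Real.exp (-f x / τ))
      μ := by
    refine hGint.integral_prod_left.neg.congr (Eventually.of_forall fun x ↦ ?_)
    show -(∫ τ in Ioc 1 T, (τ ^ 4)⁻¹ * ((1 - τ) * (R x * Real.exp (-f x / τ)))) = _
    rw [hGk x, neg_neg]
  refine ⟨hi, ?_⟩
  -- (ii) the transform
  have e1 : ∫ x, ((T ^ 2)⁻¹ * Real.exp (-f x / T) - Real.exp (-f x)) ∂μ =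
      (T ^ 2)⁻¹ * (∫ x, Real.exp (-f x / T) ∂μ) - ∫ x, Real.exp (-f x) ∂μ := by
    rw [integral_sub (hAT.const_mul _) hA1, integral_const_mul]
  have e2 : ∫ x, ((T ^ 2)⁻¹ * Real.exp (-f x / T) - Real.exp (-f x)) ∂μ =
      ∫ x, (∫ τ in Ioc 1 T, (τ ^ 4)⁻¹ * ((f x - 2 * τ) * Real.exp (-f x / τ))) ∂μ :=
    integral_congr_ae (Eventually.of_forall fun x ↦ (hftc x).symm)
  have e4 : ∫ x, (∫ τ in Ioc 1 T, (τ ^ 4)⁻¹ * ((1 - τ) * (R x * Real.exp (-f x / τ)))) ∂μ =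
      -∫ x, R x * (∫ τ in (1 : ℝ)..T, (τ - 1) / τ ^ 4 * Real.exp (-f x / τ)) ∂μ := by
    rw [← integral_neg]
    exact integral_congr_ae (Eventually.of_forall hGk)
  have key : (T ^ 2)⁻¹ * (∫ x, Real.exp (-f x / T) ∂μ) - ∫ x, Real.exp (-f x) ∂μ =
      -∫ x, R x * (∫ τ in (1 : ℝ)..T, (τ - 1) / τ ^ 4 * Real.exp (-f x / τ)) ∂μ := by
    rw [← e1, e2, hFswap, setIntegral_congr_fun measurableSet_Ioc hinner, ← hGswap, e4]
  linarith

end Summit.SmoothPoincare4.SmoothPoincare4.Theorems.ConicalGapSketch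

end
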